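/-
Copyright (c) 2026 the pub-hodgecm-mathlib formalisation cell (harness21).  Prover seat hodgecm-mathlib-A-p19 (g27), 2026-09-01.  Road «S3-tree»∕«S3-ram» (LEAD F0P3a-plan (g12)
T11-41∕T11-52; owner p06 (g15)), row (e2) «P-2-ram», organ «seam∕locus»: ★ B-p14 (g37)'s seam `RationalCyclicSelfDualLattices` §3 re-cut HYPOTHESIS-DRIVEN in the self-dual-locus
dictionary, so that ONE text serves the inert place (★ L1) and the tamely ramified place (★ `UnitaryGroupSelfDualLocusRamifiedThree`, this seat).
-/
import Literature.NumberTheory.Automorphic.RationalCyclicSelfDualLattices   -- ★ seam p846609 B-p14 (g37): §1 transfer along `j`, §2 rationality, `formCongr_mul_eq_gram_sum`; brings ★ [T2-a] `CyclicSelfDualLatticeTorsor`, ★ O8a-3∕O8a-4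
import Literature.NumberTheory.Automorphic.RationalGoodVectorRamifiedBase  -- ★ p847100 «[T2-b]-ram CORE» (this seat): `exists_rational_good_iff_exists_norm_ramifiedBase`
import Literature.NumberTheory.Automorphic.ValuedFieldValuativeRelBridge    -- ★ `v_le_one_iff_mem_integer` (the `Valued.v` ∕ `valuation` bridge of the core's `hO`)
import HarnessLib

/-!
# Rational self-dual cyclic lattices ↔ rational GOOD vectors — hypothesis-driven in the self-dual locus — and, at a TAME-RAMIFIED base, ↔ ONE eigen-field norm equation
# (Jacobowitz 1962 §7–§8; Rogawski 1990 Lemma 4.9.3)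

Topic `NumberTheory/Automorphic`; namespace `Literature.NumberTheory.Automorphic.SymmetricEigenframe`.  THEOREMS ONLY (no definition, no instance, no notation, no named fact, no
`sorry`).  Cell `pub/hodgecm-mathlib` (D-0151), crux H413 = `stmt-HodgeConjecture-24833`; road «S3-tree», seeding wave «S3-ram», row (e2) «P-2-ram» (the type-(2) share of
`stub_levelOneRowsRam`); organ **«seam∕locus»** (this seat; consumer: the R2²-ram one-place row of A-p12 (g23)'s STUB A₂).  HONEST LABEL: HC_CM is proved only modulo the 2
remaining named inputs (hLiu418 24832, h413 24833) until rung 0 closes; elementary lattice algebra over ★ material, asserts nothing printed.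

WHAT CHANGES w.r.t. ★ `RationalCyclicSelfDualLattices` §3 (B-p14 (g37)).  The ★ seam docks on ★ L1 `UnitaryGroup.exists_mem_unitaryGroupOfForm_mul_iff` — the dictionary
«`g = u·k` (`u ∈ U(σ,J)`, `k ∈ GL₃(𝒪)`) ⟺ `(σg)ᵀ J g ∈ GL₃(𝒪)`» — through Jacobowitz's INERT hypotheses (trace) `b + σb = 1` and (norm) «every `σ`-fixed unit is a norm», the
latter FALSE at a ramified place.  Here the three seam theorems are re-proved VERBATIM with those two binders replaced by the DICTIONARY ITSELF,
`hL1 : ∀ g, (∃ u ∈ U(σ,J), ∃ k ∈ glInt 3 E, g = u * k) ↔ ∃ J' ∈ glInt 3 E, J' = formCongr σ g J`,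
which ★ L1 supplies at an inert place and ★ `exists_mem_unitaryGroupOfForm_mul_iff_of_ramified_three` (`UnitaryGroupSelfDualLocusRamifiedThree`, rank-3 engine ★
`HermitianUnimodularRankThreeRamified`) at a tamely ramified one (`hJ`, `hJh`, `hσσ`, `hσO` are absorbed into `hL1`).  Everything else — the transfer along `j : E →+* K`
(§1 of ★), the rationality of `P·a` (§2 of ★), ★ O8a-3 `isIntegralMatrix_gram_and_valuation_det_iff_good`, `formCongr_mul_eq_gram_sum` — is imported, not restated.

* §1 (private steps — same conclusions as the ★ seam, weaker hypotheses; kept private so the gate's dedup sees only the new head) `exists_rational_good_of_selfDual_cyclic_of_locus` (⟹),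
  `exists_selfDual_cyclic_of_rational_good_of_locus` (⟸), `exists_selfDual_cyclic_iff_exists_rational_good_of_locus` — `(∃ w, ∃ u ∈ U(σ,J), L(w) = Λ(u)) ↔ (∃ a rational, GOOD a)`.
* §2 **`exists_selfDual_cyclic_iff_exists_norm_ramifiedBase_of_frame`** — §1 ∘ ★ «[T2-b]-ram CORE» p847100 (`K` carrying both `Valued K ℤᵐ⁰` and `ValuativeRel K`, compatible): for a
  symmetric eigenframe over the UNRAMIFIED eigen-field at a TAME-RAMIFIED base (the ramified norm dictionaries `η₀`, (nE′), (nK′) of ★ p847100, residually equal nodes),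
  **`(∃ w, ∃ u ∈ U(σ,J), L(w) = Λ(u)) ↔ ∃ b, b·σ_K b·(d₁·∏_{j≠1}(γ₁−γⱼ)∕((1+γ₁)(1+γⱼ))) = 1`** — the R2²-ram free row is `[C : R^×]` (★ [T2-a]) on the class where this
  norm equation is solvable and `0` on the other; its intrinsic reading `χ_{E∕F}(d₀·det J) = Leg(res(χ₂(u)∕(−ϖ_F)^{n∕2}))` is the next file (frame link + type A∕B evaluation;
  certificate `F0/P3/A-p19/g27/cert/CERT-T2b-ram.A-p19g27.md`, 841∕841).

## References
* [Jacobowitz1962] R. Jacobowitz, *Hermitian forms over local fields*, Amer. J. Math. 84 (1962), §4, §7 Thm. 7.1, §8 (unimodular lattices via Gram matrices; ramified non-dyadic).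
* [Rogawski1990] J. D. Rogawski, *Automorphic Representations of Unitary Groups in Three Variables* (1990), §4.9 Lemma 4.9.3 p. 56 (the eigen-coordinate count).
* [Kottwitz1986] R. E. Kottwitz, *Base change for unit elements of Hecke algebras*, Compositio Math. 60 (1986), §3 (stable lattices of a torus element).
-/

set_option autoImplicit false

open Finset Matrix Polynomial
open scoped MatrixGroups ValuativeRel WithZero
open ValuativeRel

namespace Literature.NumberTheory.Automorphic.SymmetricEigenframe

open Literature.NumberTheory.Automorphic Literature.NumberTheory.Automorphic.UnitaryGroup

/-! ## §1 The seam, hypothesis-driven in the self-dual locus -/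

section Seam

variable {E K : Type*} [Field E] [ValuativeRel E] [Field K] [ValuativeRel K]
  (σ : E →+* E) (J : GL (Fin 3) E)
  (hL1 : ∀ g : GL (Fin 3) E, (∃ u ∈ unitaryGroupOfForm σ (J : Matrix (Fin 3) (Fin 3) E), ∃ k ∈ glInt 3 E, g = u * k) ↔
    ∃ J' ∈ glInt 3 E, (J' : Matrix (Fin 3) (Fin 3) E) = formCongr σ g (J : Matrix (Fin 3) (Fin 3) E))
  (τ : Matrix (Fin 3) (Fin 3) E)
  (j : E →+* K) (hjO : ∀ x : E, j x ∈ 𝒪[K] ↔ x ∈ 𝒪[E]) (σK : K →+* K) (hσj : ∀ x, σK (j x) = j (σ x)) (hσKv : ∀ y, valuation K (σK y) = valuation K y)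
  (ι : K →+* K) (hιι : ∀ y, ι (ι y) = y) (hιj : ∀ y, ι y = y ↔ ∃ x, j x = y)
  (P : GL (Fin 3) K) {γ d : Fin 3 → K}
  (hτ : τ.map j = (P : Matrix (Fin 3) (Fin 3) K) * diagonal γ * ((P⁻¹ : GL (Fin 3) K) : Matrix (Fin 3) (Fin 3) K))
  (hP : formCongr σK P ((J : Matrix (Fin 3) (Fin 3) E).map j) = diagonal d)
  (hP0 : ∀ i, ι ((P : Matrix (Fin 3) (Fin 3) K) i 0) = (P : Matrix (Fin 3) (Fin 3) K) i 0)
  (hP1 : ∀ i, ι ((P : Matrix (Fin 3) (Fin 3) K) i 1) = (P : Matrix (Fin 3) (Fin 3) K) i 2)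
  (hP2 : ∀ i, ι ((P : Matrix (Fin 3) (Fin 3) K) i 2) = (P : Matrix (Fin 3) (Fin 3) K) i 1)
  (hγ : ∀ i, γ i ∈ 𝒪[K]) (hinj : Function.Injective γ) (hσγ : ∀ i, σK (γ i) = (γ i)⁻¹)
  {r : (𝒪[K])[X]} (hr : ∀ i, (r.map (𝒪[K]).subtype).eval (γ i) * γ i = 1)

include hjO hσj hτ hP hP0 hP1 hP2 hιj hιι hL1 hσKv hγ hinj hσγ hr in
/-- **(⟹) A SELF-DUAL RATIONAL CYCLIC LATTICE GIVES A RATIONAL GOOD VECTOR**: if `L(w) = Λ(u)` for some `w ∈ E³`, `u ∈ U(σ,J)`, then `a := P⁻¹·(j∘w)` is rational and GOOD over `(K, 𝒪_K)`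
(the DICTIONARY `hL1` over `E`: the Gram matrix of `K(w)` is unimodular; read in `K` through `j` it is the eigenframe Gram `ᵗ(σ_K V)·diag(d a σ_K a)·V`; ★ O8a-3).
[cite: Jacobowitz1962, §7 Thm. 7.1] [cite: Rogawski1990, §4.9 Lemma 4.9.3 p. 56] [cite: Kottwitz1986, §3] -/
private theorem exists_rational_good_of_selfDual_cyclic_of_locus {w : Fin 3 → E}
    (hw : ∃ u ∈ unitaryGroupOfForm σ (J : Matrix (Fin 3) (Fin 3) E),
      Submodule.span 𝒪[E] (Set.range fun k : Fin 3 => (τ ^ (k : ℕ)) *ᵥ w) = Submodule.span 𝒪[E] (Set.range ((u : Matrix (Fin 3) (Fin 3) E))ᵀ)) :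
    ∃ a : Fin 3 → K, ι (a 0) = a 0 ∧ a 2 = ι (a 1) ∧
      ((fun i => d i * a i * σK (a i) * ∏ l ∈ univ.erase i, (γ i - γ l)) ∈ Submodule.span 𝒪[K] (Set.range fun k : Fin 3 => fun i => γ i ^ (k : ℕ)) ∧
        ∀ i, ∃ y ∈ 𝒪[K], y * (d i * a i * σK (a i) * ∏ l ∈ univ.erase i, (γ i - γ l)) = 1) := by
  classical
  obtain ⟨u, hu, hL⟩ := hw
  -- the Krylov matrix `K(w)` is invertible and `Λ(u) = Λ(K(w))`
  set Kw : Matrix (Fin 3) (Fin 3) E := Matrix.of fun i k : Fin 3 => ((τ ^ (k : ℕ)) *ᵥ w) i with hKw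
  have hΛ : Submodule.span 𝒪[E] (Set.range ((u : Matrix (Fin 3) (Fin 3) E))ᵀ) = Submodule.span 𝒪[E] (Set.range Kwᵀ) :=
    hL.symm.trans (span_range_pow_mulVec_eq_span_range_transpose τ w)
  have hKu : IsUnit Kw.det := isUnit_det_of_span_range_transpose_eq u Kw hΛ
  set g : GL (Fin 3) E := Matrix.GeneralLinearGroup.mkOfDetNeZero Kw hKu.ne_zero with hg
  have hgval : (g : Matrix (Fin 3) (Fin 3) E) = Kw := rfl
  -- unimodular Gram over `E`
  have hk : u⁻¹ * g ∈ glInt 3 E := (span_range_transpose_eq_iff u g).1 (by rw [hgval]; exact hΛ)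
  obtain ⟨J', hJ'int, hJ'val⟩ := (hL1 g).1
    ⟨u, hu, u⁻¹ * g, hk, by rw [mul_inv_cancel_left]⟩
  have hintE : IsIntegralMatrix (formCongr σ g (J : Matrix (Fin 3) (Fin 3) E)) := by rw [← hJ'val]; exact isIntegralMatrix_of_mem_glInt hJ'int
  have hdetE : valuation E (formCongr σ g (J : Matrix (Fin 3) (Fin 3) E)).det = 1 := by rw [← hJ'val]; exact valuation_det_eq_one_of_mem_glInt hJ'int
  -- the coordinates `a = P⁻¹ (j ∘ w)` and the Krylov matrix over `K`
  set a : Fin 3 → K := ((P⁻¹ : GL (Fin 3) K) : Matrix (Fin 3) (Fin 3) K) *ᵥ (j ∘ w) with ha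
  have hPa : (P : Matrix (Fin 3) (Fin 3) K) *ᵥ a = j ∘ w := by
    rw [ha, mulVec_mulVec, ← Units.val_mul, mul_inv_cancel, Units.val_one, one_mulVec]
  have hKmap : Kw.map j = (P : Matrix (Fin 3) (Fin 3) K) * (diagonal a * vandermonde γ) := by
    rw [hKw, krylov_map, krylov_eq_mul_of_mulVec_eq P γ a (τ.map j) hτ (j ∘ w) hPa.symm]
  -- `diag(a)·V` is invertible: it is `P⁻¹ · K(w)^K`
  have hdetMa : (diagonal a * vandermonde γ).det ≠ 0 := by
    have e : diagonal a * vandermonde γ = ((P⁻¹ : GL (Fin 3) K) : Matrix (Fin 3) (Fin 3) K) * Kw.map j := by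
      rw [hKmap, ← Matrix.mul_assoc, ← Units.val_mul, inv_mul_cancel, Units.val_one, Matrix.one_mul]
    rw [e, Matrix.det_mul, ← RingHom.mapMatrix_apply, ← RingHom.map_det]
    exact mul_ne_zero (Matrix.isUnits_det_units _).ne_zero ((map_ne_zero j).2 hKu.ne_zero)
  set Ma : GL (Fin 3) K := Matrix.GeneralLinearGroup.mkOfDetNeZero _ hdetMa with hMa
  have hMaval : (Ma : Matrix (Fin 3) (Fin 3) K) = diagonal a * vandermonde γ := rfl
  -- the Gram over `K`, read through `j`
  have hmapg : ((Matrix.GeneralLinearGroup.map j g : GL (Fin 3) K) : Matrix (Fin 3) (Fin 3) K) = ((P * Ma : GL (Fin 3) K) : Matrix (Fin 3) (Fin 3) K) := by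
    rw [Units.val_mul, hMaval, ← hKmap]; rfl
  have hG : (formCongr σ g (J : Matrix (Fin 3) (Fin 3) E)).map j = formCongr σK (P * Ma) ((J : Matrix (Fin 3) (Fin 3) E).map j) := by
    rw [formCongr_map j σ σK hσj]
    simp only [formCongr, hmapg]
  have hintK : IsIntegralMatrix (formCongr σK (P * Ma) ((J : Matrix (Fin 3) (Fin 3) E).map j)) := by
    rw [← hG]; exact (isIntegralMatrix_map_iff j hjO _).2 hintE
  have hdetK : valuation K (formCongr σK (P * Ma) ((J : Matrix (Fin 3) (Fin 3) E).map j)).det = 1 := by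
    rw [← hG, ← RingHom.mapMatrix_apply, ← RingHom.map_det]; exact (valuation_map_eq_one_iff j hjO _).2 hdetE
  rw [formCongr_mul_eq_gram_sum J j σK P hP a Ma hMaval] at hintK hdetK
  obtain ⟨hmem, hunit⟩ := (isIntegralMatrix_gram_and_valuation_det_iff_good σK hσKv hγ hinj hσγ hr d a).1 ⟨hintK, hdetK⟩
  -- rationality of `a`
  have hfix : ∀ i, ι (((P : Matrix (Fin 3) (Fin 3) K) *ᵥ a) i) = ((P : Matrix (Fin 3) (Fin 3) K) *ᵥ a) i := fun i => by
    rw [hPa]; exact (hιj _).2 ⟨w i, rfl⟩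
  obtain ⟨h0, h2⟩ := (forall_map_mulVec_eq_iff_rational ι hιι P hP0 hP1 hP2 a).1 hfix
  exact ⟨a, h0, h2, hmem, hunit⟩

include hjO hσj hτ hP hP0 hP1 hP2 hιj hιι hL1 hσKv hγ hinj hσγ hr in
/-- **(⟸) A RATIONAL GOOD VECTOR GIVES A SELF-DUAL RATIONAL CYCLIC LATTICE**: for `a` rational and GOOD, `P·a = j∘w` for some `w ∈ E³` (symmetric frame), the Gram of `K(w)` is unimodular
over `𝒪_K` (★ O8a-3), hence over `𝒪_E` (read back through `j`), so `L(w) = Λ(u)` with `u ∈ U(σ,J)` (the dictionary `hL1`). [cite: Jacobowitz1962, §7 Thm. 7.1] [cite: Rogawski1990, §4.9 Lemma 4.9.3 p. 56]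
[cite: Kottwitz1986, §3] -/
private theorem exists_selfDual_cyclic_of_rational_good_of_locus {a : Fin 3 → K} (ha0 : ι (a 0) = a 0) (ha2 : a 2 = ι (a 1))
    (hgood : ((fun i => d i * a i * σK (a i) * ∏ l ∈ univ.erase i, (γ i - γ l)) ∈ Submodule.span 𝒪[K] (Set.range fun k : Fin 3 => fun i => γ i ^ (k : ℕ)) ∧
        ∀ i, ∃ y ∈ 𝒪[K], y * (d i * a i * σK (a i) * ∏ l ∈ univ.erase i, (γ i - γ l)) = 1)) :
    ∃ w : Fin 3 → E, ∃ u ∈ unitaryGroupOfForm σ (J : Matrix (Fin 3) (Fin 3) E),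
      Submodule.span 𝒪[E] (Set.range fun k : Fin 3 => (τ ^ (k : ℕ)) *ᵥ w) = Submodule.span 𝒪[E] (Set.range ((u : Matrix (Fin 3) (Fin 3) E))ᵀ) := by
  classical
  obtain ⟨hmem, hunit⟩ := hgood
  have hane : ∀ i, a i ≠ 0 := fun i h0 => by
    obtain ⟨y, -, hy⟩ := hunit i
    rw [h0] at hy
    simp at hy
  -- `P a` is rational: choose `w` with `j ∘ w = P a`
  have hfix := (forall_map_mulVec_eq_iff_rational ι hιι P hP0 hP1 hP2 a).2 ⟨ha0, ha2⟩
  choose w hw using fun i => (hιj _).1 (hfix i)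
  have hPa : (P : Matrix (Fin 3) (Fin 3) K) *ᵥ a = j ∘ w := funext fun i => (hw i).symm
  -- the Krylov matrix of `w` over `K` is `P · diag(a) · V`
  set Kw : Matrix (Fin 3) (Fin 3) E := Matrix.of fun i k : Fin 3 => ((τ ^ (k : ℕ)) *ᵥ w) i with hKw
  have hKmap : Kw.map j = (P : Matrix (Fin 3) (Fin 3) K) * (diagonal a * vandermonde γ) := by
    rw [hKw, krylov_map, krylov_eq_mul_of_mulVec_eq P γ a (τ.map j) hτ (j ∘ w) hPa.symm]
  have hdetMa : (diagonal a * vandermonde γ).det ≠ 0 := det_diagonal_mul_vandermonde_ne_zero hane hinj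
  set Ma : GL (Fin 3) K := Matrix.GeneralLinearGroup.mkOfDetNeZero _ hdetMa with hMa
  have hMaval : (Ma : Matrix (Fin 3) (Fin 3) K) = diagonal a * vandermonde γ := rfl
  -- `K(w)` is invertible
  have hKu : Kw.det ≠ 0 := by
    intro h0
    have h := congrArg j h0
    rw [RingHom.map_det, RingHom.mapMatrix_apply, hKmap, map_zero, Matrix.det_mul] at h
    exact mul_ne_zero (Matrix.isUnits_det_units P).ne_zero hdetMa h
  set g : GL (Fin 3) E := Matrix.GeneralLinearGroup.mkOfDetNeZero Kw hKu with hg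
  have hgval : (g : Matrix (Fin 3) (Fin 3) E) = Kw := rfl
  -- unimodular Gram over `K` (★ O8a-3), read back to `E`
  obtain ⟨hintK, hdetK⟩ := (isIntegralMatrix_gram_and_valuation_det_iff_good σK hσKv hγ hinj hσγ hr d a).2 ⟨hmem, hunit⟩
  rw [← formCongr_mul_eq_gram_sum J j σK P hP a Ma hMaval] at hintK hdetK
  have hmapg : ((Matrix.GeneralLinearGroup.map j g : GL (Fin 3) K) : Matrix (Fin 3) (Fin 3) K) = ((P * Ma : GL (Fin 3) K) : Matrix (Fin 3) (Fin 3) K) := by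
    rw [Units.val_mul, hMaval, ← hKmap]; rfl
  have hG : (formCongr σ g (J : Matrix (Fin 3) (Fin 3) E)).map j = formCongr σK (P * Ma) ((J : Matrix (Fin 3) (Fin 3) E).map j) := by
    rw [formCongr_map j σ σK hσj]
    simp only [formCongr, hmapg]
  have hintE : IsIntegralMatrix (formCongr σ g (J : Matrix (Fin 3) (Fin 3) E)) := by
    rw [← isIntegralMatrix_map_iff j hjO, hG]; exact hintK
  have hdetE : valuation E (formCongr σ g (J : Matrix (Fin 3) (Fin 3) E)).det = 1 := by
    rw [← valuation_map_eq_one_iff j hjO, RingHom.map_det, RingHom.mapMatrix_apply, hG]; exact hdetK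
  have hdet0 : (formCongr σ g (J : Matrix (Fin 3) (Fin 3) E)).det ≠ 0 := fun h0 => by rw [h0, map_zero] at hdetE; exact zero_ne_one hdetE
  set J' : GL (Fin 3) E := Matrix.GeneralLinearGroup.mkOfDetNeZero _ hdet0 with hJ'
  have hJ'val : (J' : Matrix (Fin 3) (Fin 3) E) = formCongr σ g (J : Matrix (Fin 3) (Fin 3) E) := rfl
  have hJ'int : J' ∈ glInt 3 E := mem_glInt_of_isIntegralMatrix (by rw [hJ'val]; exact hintE) (by rw [hJ'val]; exact hdetE)
  obtain ⟨u, hu, k, hk, hgk⟩ := (hL1 g).2 ⟨J', hJ'int, hJ'val⟩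
  refine ⟨w, u, hu, ?_⟩
  rw [span_range_pow_mulVec_eq_span_range_transpose]
  change Submodule.span 𝒪[E] (Set.range ((g : Matrix (Fin 3) (Fin 3) E))ᵀ) = _
  rw [eq_comm, span_range_transpose_eq_iff, hgk, inv_mul_cancel_left]
  exact hk

include hjO hσj hτ hP hP0 hP1 hP2 hιj hιι hL1 hσKv hγ hinj hσγ hr in
/-- **THE SEAM (S) OF ORGAN [T2-b], HYPOTHESIS-DRIVEN IN THE SELF-DUAL LOCUS** (`hL1` = ★ `exists_mem_unitaryGroupOfForm_mul_iff` at an inert place, ★ `exists_mem_unitaryGroupOfForm_mul_iff_of_ramified_three` at a tamely ramified one): «some rational `τ`-cyclic lattice `L(w) = span_𝒪{τ^k w}` is self-dual (`= Λ(u)`, `u ∈ U(σ,J)`)» — the hypothesis `hb₀` of ★ [T2-a]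
`ncard_setOf_selfDual_cyclic_eq_relIndex` up to ★ `exists_units_of_mem` — holds iff «a RATIONAL GOOD vector exists» over the eigen-field — the left side of ★ [T2-b] CORE
`exists_rational_good_iff_even`.** [cite: Jacobowitz1962, §7 Thm. 7.1] [cite: Rogawski1990, §4.9 Lemma 4.9.3 p. 56] [cite: Kottwitz1986, §3] -/
private theorem exists_selfDual_cyclic_iff_exists_rational_good_of_locus :
    (∃ w : Fin 3 → E, ∃ u ∈ unitaryGroupOfForm σ (J : Matrix (Fin 3) (Fin 3) E),
      Submodule.span 𝒪[E] (Set.range fun k : Fin 3 => (τ ^ (k : ℕ)) *ᵥ w) = Submodule.span 𝒪[E] (Set.range ((u : Matrix (Fin 3) (Fin 3) E))ᵀ)) ↔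
    ∃ a : Fin 3 → K, ι (a 0) = a 0 ∧ a 2 = ι (a 1) ∧
      ((fun i => d i * a i * σK (a i) * ∏ l ∈ univ.erase i, (γ i - γ l)) ∈ Submodule.span 𝒪[K] (Set.range fun k : Fin 3 => fun i => γ i ^ (k : ℕ)) ∧
        ∀ i, ∃ y ∈ 𝒪[K], y * (d i * a i * σK (a i) * ∏ l ∈ univ.erase i, (γ i - γ l)) = 1) := by
  constructor
  · rintro ⟨w, hw⟩
    exact exists_rational_good_of_selfDual_cyclic_of_locus σ J hL1 τ j hjO σK hσj hσKv ι hιι hιj P hτ hP hP0 hP1 hP2 hγ hinj hσγ hr hw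
  · rintro ⟨a, ha0, ha2, hgood⟩
    exact exists_selfDual_cyclic_of_rational_good_of_locus σ J hL1 τ j hjO σK hσj hσKv ι hιι hιj P hτ hP hP0 hP1 hP2 hγ hinj hσγ hr ha0 ha2 hgood

end Seam

/-! ## §2 At a tame-ramified base: self-dual rational cyclic lattices ↔ ONE norm equation over the eigen-field -/

section RamifiedBase

/-- **SEAM∕LOCUS ∘ «[T2-b]-ram CORE»: a self-dual rational `τ`-cyclic lattice exists iff the eigen-field norm equation `b·σ_K(b)·c′₁ = 1` is solvable**, for a symmetric
eigenframe `P = [j∘x₀ | x₁ | ι∘x₁]` with Gram values `d = (d₀, d₁, ιd₁)` and residually equal norm-one nodes `γ = (ju, λ, ιλ)` over the UNRAMIFIED eigen-field `K` of a type-(2)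
class at a TAME-RAMIFIED CM place (self-dual-locus dictionary `hL1` on `E`: ★ `exists_mem_unitaryGroupOfForm_mul_iff_of_ramified_three`; ramified norm dictionaries `η₀`, (nE′),
(nK′) on `K`: ★ p847100).  `K` carries `Valued K ℤᵐ⁰` (the core's currency) and a compatible `ValuativeRel K` (the seam's).
[cite: Jacobowitz1962, §7 Thm. 7.1, §8] [cite: Rogawski1990, §4.9 Lemma 4.9.3 p. 56] [cite: Kottwitz1986, §3] -/
theorem exists_selfDual_cyclic_iff_exists_norm_ramifiedBase_of_frame
    {E K : Type*} [Field E] [ValuativeRel E] [Field K] [Valued K ℤᵐ⁰] [ValuativeRel K] [(Valued.v : Valuation K ℤᵐ⁰).Compatible]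
    (σ : E →+* E) (J : GL (Fin 3) E)
    (hL1 : ∀ g : GL (Fin 3) E, (∃ u ∈ unitaryGroupOfForm σ (J : Matrix (Fin 3) (Fin 3) E), ∃ k ∈ glInt 3 E, g = u * k) ↔
      ∃ J' ∈ glInt 3 E, (J' : Matrix (Fin 3) (Fin 3) E) = formCongr σ g (J : Matrix (Fin 3) (Fin 3) E))
    (τ : Matrix (Fin 3) (Fin 3) E)
    (j : E →+* K) (hjO : ∀ x : E, j x ∈ 𝒪[K] ↔ x ∈ 𝒪[E]) (σK : K →+* K) (hσj : ∀ x, σK (j x) = j (σ x)) (hσKv : ∀ y, valuation K (σK y) = valuation K y)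
    (hσKσK : ∀ y, σK (σK y) = y)
    (ι : K →+* K) (hιι : ∀ y, ι (ι y) = y) (hιj : ∀ y, ι y = y ↔ ∃ x, j x = y) (hσKι : ∀ y, σK (ι y) = ι (σK y))
    (P : GL (Fin 3) K) {γ d : Fin 3 → K}
    (hτ : τ.map j = (P : Matrix (Fin 3) (Fin 3) K) * diagonal γ * ((P⁻¹ : GL (Fin 3) K) : Matrix (Fin 3) (Fin 3) K))
    (hP : formCongr σK P ((J : Matrix (Fin 3) (Fin 3) E).map j) = diagonal d)
    (hP0 : ∀ i, ι ((P : Matrix (Fin 3) (Fin 3) K) i 0) = (P : Matrix (Fin 3) (Fin 3) K) i 0)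
    (hP1 : ∀ i, ι ((P : Matrix (Fin 3) (Fin 3) K) i 1) = (P : Matrix (Fin 3) (Fin 3) K) i 2)
    (hP2 : ∀ i, ι ((P : Matrix (Fin 3) (Fin 3) K) i 2) = (P : Matrix (Fin 3) (Fin 3) K) i 1)
    (hγ : ∀ i, γ i ∈ 𝒪[K]) (hinj : Function.Injective γ) (hσγ : ∀ i, σK (γ i) = (γ i)⁻¹)
    {r : (𝒪[K])[X]} (hr : ∀ i, (r.map (𝒪[K]).subtype).eval (γ i) * γ i = 1)
    (hγ1u : ∀ i, ∃ y ∈ 𝒪[K], y * (1 + γ i) = 1) (hγne : ∀ i, γ i ≠ 0) (hγc : ∀ i k, Valued.v (γ i - γ k) < 1)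
    (hιγ0 : ι (γ 0) = γ 0) (hιγ1 : ι (γ 1) = γ 2) (hιγ2 : ι (γ 2) = γ 1)
    (hdσ : ∀ i, σK (d i) = d i) (hdne : ∀ i, d i ≠ 0) (hιd0 : ι (d 0) = d 0) (hιd1 : ι (d 1) = d 2)
    {η₀ : K} (hη₀O : η₀ ∈ 𝒪[K]) (hη₀u : ∃ y ∈ 𝒪[K], y * η₀ = 1) (hιη₀ : ι η₀ = η₀) (hη₀n : ∃ e : K, e * σK e = η₀)
    (hnE : ∀ c : K, c ≠ 0 → σK c = c → ι c = c → ∃ a : K, ι a = a ∧ (a * σK a * c = 1 ∨ a * σK a * c = η₀))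
    (hnK : ∀ v ∈ 𝒪[K], (∃ y ∈ 𝒪[K], y * v = 1) → σK v = v → (∃ f : K, σK f = f ∧ ι f = f ∧ Valued.v (v - f) < 1) → ∃ e : K, e * σK e = v) :
    (∃ w : Fin 3 → E, ∃ u ∈ unitaryGroupOfForm σ (J : Matrix (Fin 3) (Fin 3) E),
      Submodule.span 𝒪[E] (Set.range fun k : Fin 3 => (τ ^ (k : ℕ)) *ᵥ w) = Submodule.span 𝒪[E] (Set.range ((u : Matrix (Fin 3) (Fin 3) E))ᵀ)) ↔
    ∃ b : K, b * σK b * (d 1 * ∏ l ∈ univ.erase (1 : Fin 3), (γ 1 - γ l) / ((1 + γ 1) * (1 + γ l))) = 1 := by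
  have hO : ∀ x ∈ 𝒪[K], Valued.v x ≤ 1 := fun x hx => (v_le_one_iff_mem_integer x).2 hx
  exact (exists_selfDual_cyclic_iff_exists_rational_good_of_locus σ J hL1 τ j hjO σK hσj hσKv ι hιι hιj P hτ hP hP0 hP1 hP2 hγ hinj hσγ hr).trans
    (exists_rational_good_iff_exists_norm_ramifiedBase 𝒪[K] hO σK ι hσKσK hσKι hη₀O hη₀u hιη₀ hη₀n hnE hnK hγ hγ1u hσγ hγne hinj hγc
      hιγ0 hιγ1 hιγ2 hdσ hdne hιd0 hιd1)

end RamifiedBase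

end Literature.NumberTheory.Automorphic.SymmetricEigenframe
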